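import Literature.Probability.Percolation.ZdFiveArmUpperBound
import Literature.Probability.Percolation.ZdFiveArmQuasiMultOfSeparation
import HarnessLib

/-!
# `DuminilCopinManolescuTassion2021_zdFiveArm_upperBound`: the proof from Kesten's separation theorem

Topic `Literature/Probability/Percolation`; critical bond percolation on `ℤ²`.  This file assembles
the printed proof of the two-radii five-arm upper bound `P[𝒜₅(A_{r,R})] ≤ C (r/R)²`
(`DuminilCopinManolescuTassion2021_zdFiveArm_upperBound`, `ZdFiveArmUpperBound.lean`) from its
three steps — `(U)` the point bound, `(Q)` quasi-multiplicativity, `(L)` the matching lower bound —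
via the landed reduction `DuminilCopinManolescuTassion2021_zdFiveArm_upperBound_of_pointBound_quasiMult`.
The steps `(U)` (`ZdFiveArmPointBoundOfSeparation.lean`) and `(Q)`
(`ZdFiveArmQuasiMultOfSeparation.lean`) are proved in the tree CONDITIONALLY on Kesten's
arm-separation lower bound for bond percolation on `ℤ²`,

  `hsep : ∃ c > 0, ∃ n₀, ∀ n N, n₀ ≤ n → 2n ≤ N → c · P(zdFiveArmClusters n N) ≤ P(zdFiveArmSep n N)`

(Kesten 1987, Lemma 4 with (2.26)–(2.28); Nolin 2008, Thm. 11 [arXiv: Thm. 10], §8.1 for bond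
percolation; DMT 2021, Props. 6.2, 6.5 for `1 ≤ q < 4`), the one input of the printed proof that
is not yet formalized (a theory of its own: Kesten's fences); `(L)` enters as the displayed
hypothesis `h5` (the five-arm lower bound at well-spaced radii, Nolin 2008, Thm. 24 (ii); the
subject of `ZdFiveArmCounting.lean`, `ZdFiveArmDuality.lean`, … in the tree).  The final theorem
`DuminilCopinManolescuTassion2021_zdFiveArm_upperBound_of_separation` therefore reduces the named
fact to exactly these two displayed statements; no new named fact is introduced.

## References

* H. Duminil-Copin, I. Manolescu, V. Tassion, *Planar random-cluster model: fractal properties of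
  the critical phase*, PTRF 181 (2021), §6.2–6.4, Props. 6.2, 6.3, 6.5, 6.6
  [DuminilCopinManolescuTassion2021].
* H. Kesten, *Scaling relations for 2D-percolation*, CMP 109 (1987), Lemmas 4, 6, (2.43)
  [KestenScalingCMP1987].
* H. Kesten, V. Sidoravicius, Y. Zhang, EJP 3 (1998), Lemma 5 [KestenSidoraviciusZhang1998].
* P. Nolin, *Near-critical percolation in two dimensions*, EJP 13 (2008), Thm. 11, Prop. 12,
  Prop. 16, Prop. 17, Thm. 24 [Nolin2008].

Tree: `ZdFiveArmUpperBound.lean`, `ZdFiveArmPointBoundOfSeparation.lean`,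
`ZdFiveArmQuasiMultOfSeparation.lean`, `ZdFiveArmMonotone.lean`.
-/

noncomputable section

open Set _root_.MeasureTheory

namespace Literature.Probability.Percolation

open LatticeModels

/-! ### The five-arm upper bound from separation (final assembly) -/

section Assembly

/-- **`(U)` with an explicit threshold**: the point bound `P(zdFiveArmClusters m₁ N) ≤ C / N²`
(`N ≥ m₁`) for every `m₁ ≥ 128` from which the separation bound holds
(`real_zdFiveArmSep_mul_le_one`). [cite: KestenSidoraviciusZhang1998, Lemma 5] [cite: Nolin2008, §5.2, Thm. 24] -/
theorem zdFiveArm_pointBound_of_separation' {m₁ : ℕ} (hm₁ : 128 ≤ m₁) {cs : ℝ} (hcs : 0 < cs)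
    (hsep : ∀ n N : ℕ, m₁ ≤ n → 2 * n ≤ N →
      cs * (bondPercolation (zdGraph 2) half).real (zdFiveArmClusters n N) ≤
        (bondPercolation (zdGraph 2) half).real (zdFiveArmSep n N)) :
    ∃ C : ℝ, ∀ N : ℕ, m₁ ≤ N →
      (bondPercolation (zdGraph 2) half).real (zdFiveArmClusters m₁ N) ≤ C / (N : ℝ) ^ 2 := by
  obtain ⟨c, hc0, hc⟩ := rsw_lowerBound_holds 1024 (by norm_num)
  set b := c ^ 10 * (1 / 2 : ℝ) ^ (2 * (m₁ / 64 + 1)) * (1 / 2 : ℝ) ^ (hubPairs (m₁ / 2 - 1)).card with hb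
  have hb0 : 0 < b := by positivity
  refine ⟨1 / (4 * cs * b) + 4 * (m₁ : ℝ) ^ 2, fun N hkN => ?_⟩
  set μ := bondPercolation (zdGraph 2) half with hμ
  have hN0 : (0 : ℝ) < N := by exact_mod_cast (show 0 < N by omega)
  have hN2 : (0 : ℝ) < (N : ℝ) ^ 2 := by positivity
  rw [le_div_iff₀ hN2]
  have hk0 : 0 ≤ 4 * (m₁ : ℝ) ^ 2 := by positivity
  have h4 : 0 ≤ 1 / (4 * cs * b) := by positivity
  have hK0 : 0 ≤ μ.real (zdFiveArmClusters m₁ N) := measureReal_nonneg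
  have hK1 : μ.real (zdFiveArmClusters m₁ N) ≤ 1 := measureReal_le_one
  by_cases h2 : 2 * m₁ ≤ N
  · have h1 := real_zdFiveArmSep_mul_le_one hm₁ h2 hc0 hc
    rw [← hb] at h1
    have hs := hsep m₁ N le_rfl h2
    have hA : 4 * (N : ℝ) ^ 2 ≤ (2 * (N : ℝ) + 1) ^ 2 := by nlinarith [hN0]
    have hS0 : 0 ≤ μ.real (zdFiveArmSep m₁ N) := measureReal_nonneg
    have hP : μ.real (zdFiveArmClusters m₁ N) * (N : ℝ) ^ 2 ≤ 1 / (4 * cs * b) := by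
      rw [le_div_iff₀ (by positivity)]
      calc μ.real (zdFiveArmClusters m₁ N) * (N : ℝ) ^ 2 * (4 * cs * b)
          = 4 * (N : ℝ) ^ 2 * b * (cs * μ.real (zdFiveArmClusters m₁ N)) := by ring
        _ ≤ 4 * (N : ℝ) ^ 2 * b * μ.real (zdFiveArmSep m₁ N) :=
            mul_le_mul_of_nonneg_left hs (by positivity)
        _ ≤ (2 * (N : ℝ) + 1) ^ 2 * b * μ.real (zdFiveArmSep m₁ N) :=
            mul_le_mul_of_nonneg_right (mul_le_mul_of_nonneg_right hA hb0.le) hS0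
        _ ≤ 1 := h1
    linarith [hP, hk0]
  · have h2' := not_le.1 h2
    have hNk : (N : ℝ) < 2 * m₁ := by exact_mod_cast h2'
    have h3 : (N : ℝ) ^ 2 ≤ 4 * (m₁ : ℝ) ^ 2 := by nlinarith [hNk, hN0]
    calc μ.real (zdFiveArmClusters m₁ N) * (N : ℝ) ^ 2 ≤ 1 * (4 * (m₁ : ℝ) ^ 2) :=
          mul_le_mul hK1 h3 hN2.le zero_le_one
      _ ≤ 1 / (4 * cs * b) + 4 * (m₁ : ℝ) ^ 2 := by linarith [h4]

/-- **`DuminilCopinManolescuTassion2021_zdFiveArm_upperBound` from Kesten's arm-separation theorem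
and the a-priori five-arm lower bound.**  The printed proof of the two-radii upper bound
`P[𝒜₅(A_{r,R})] ≤ C (r/R)²` (DMT 2021, Prop. 6.6 ← Props. 6.3, 6.5; KSZ 1998, Lemma 5 "by the
method of Lemma 6 in Kesten (1987)"; Nolin 2008, Thm. 24 via Prop. 12 and Thm. 11) consists of
`(U)` the point bound (`zdFiveArm_pointBound_of_separation'`), `(Q)` quasi-multiplicativity
(`zdFiveArm_quasiMult_of_separation`) and `(L)` the matching lower bound; `(U)` and `(Q)` are proved
in the tree from the arm-separation lower bound `hsep` (Kesten 1987, Lemma 4; Nolin 2008, Thm. 11,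
for bond percolation on `ℤ²`, §8.1), which is the one input not yet formalized, and `(L)` enters
through `h5` (Nolin 2008, Thm. 24 (ii)).  Given both, the named fact follows by
`DuminilCopinManolescuTassion2021_zdFiveArm_upperBound_of_pointBound_quasiMult`.
[cite: DuminilCopinManolescuTassion2021, §6.4, Prop. 6.6 (q = 1)] [cite: Nolin2008, §5.2, Thm. 24 and §4.3, Thm. 11, Prop. 12] [cite: KestenSidoraviciusZhang1998, Lemma 5] -/
theorem DuminilCopinManolescuTassion2021_zdFiveArm_upperBound_of_separation
    (hsep : ∃ c : ℝ, 0 < c ∧ ∃ n₀ : ℕ, ∀ n N : ℕ, n₀ ≤ n → 2 * n ≤ N →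
      c * (bondPercolation (zdGraph 2) half).real (zdFiveArmClusters n N) ≤
        (bondPercolation (zdGraph 2) half).real (zdFiveArmSep n N))
    (h5 : ∃ (A : ℕ) (cL : ℝ), 0 < cL ∧ ∀ r R : ℕ, 1 ≤ r → A * r ≤ R →
      cL * ((r : ℝ) / R) ^ 2 ≤ (bondPercolation (zdGraph 2) half).real (zdFiveArmClusters r R)) :
    DuminilCopinManolescuTassion2021_zdFiveArm_upperBound := by
  obtain ⟨cs, hcs, n₀, hsep⟩ := hsep
  obtain ⟨A, cL, hcL, h5⟩ := h5
  set m₁ := max n₀ 128 with hm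
  have hm₁ : 128 ≤ m₁ := le_max_right _ _
  have hn₀ : n₀ ≤ m₁ := le_max_left _ _
  have hm1 : 1 ≤ m₁ := by omega
  have hsep' : ∀ n N : ℕ, m₁ ≤ n → 2 * n ≤ N →
      cs * (bondPercolation (zdGraph 2) half).real (zdFiveArmClusters n N) ≤
        (bondPercolation (zdGraph 2) half).real (zdFiveArmSep n N) :=
    fun n N hn hN => hsep n N (hn₀.trans hn) hN
  obtain ⟨C, hU⟩ := zdFiveArm_pointBound_of_separation' hm₁ hcs hsep'
  obtain ⟨c, hc, hQ⟩ := zdFiveArm_quasiMult_of_separation hm₁ hcs hsep' hcL h5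
  -- `(L)` for the inner radius `m₁` from `h5`
  set B := max 1 A with hB
  have hB1 : 1 ≤ B := le_max_left _ _
  have hL : ∀ m : ℕ, m₁ ≤ m →
      cL * (m₁ : ℝ) ^ 2 / (B : ℝ) ^ 2 / (m : ℝ) ^ 2 ≤ (bondPercolation (zdGraph 2) half).real (zdFiveArmClusters m₁ m) := by
    intro m hm'
    set R' := max m (A * m₁) with hR'
    have h1 := h5 m₁ R' hm1 (le_max_right _ _)
    have h2 : (bondPercolation (zdGraph 2) half).real (zdFiveArmClusters m₁ R') ≤
        (bondPercolation (zdGraph 2) half).real (zdFiveArmClusters m₁ m) :=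
      real_zdFiveArmClusters_mono half le_rfl hm' (le_max_left _ _)
    refine le_trans ?_ (h1.trans h2)
    have hm0 : (0 : ℝ) < m := by exact_mod_cast (show 0 < m by omega)
    have hR'0 : (0 : ℝ) < R' := by exact_mod_cast (show 0 < R' from lt_of_lt_of_le (by omega) (le_max_left _ _))
    have hB0 : (0 : ℝ) < B := by exact_mod_cast (show 0 < B by omega)
    have hR'le : (R' : ℝ) ≤ (B : ℝ) * m := by
      have : R' ≤ B * m := by
        rw [hR']
        refine max_le ?_ ?_
        · calc m = 1 * m := (one_mul m).symm
            _ ≤ B * m := Nat.mul_le_mul_right _ hB1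
        · calc A * m₁ ≤ A * m := Nat.mul_le_mul_left _ hm'
            _ ≤ B * m := Nat.mul_le_mul_right _ (le_max_right _ _)
      exact_mod_cast this
    have hq : (m₁ : ℝ) / ((B : ℝ) * m) ≤ (m₁ : ℝ) / R' :=
      div_le_div_of_nonneg_left (by positivity) hR'0 hR'le
    have hq' : ((m₁ : ℝ) / ((B : ℝ) * m)) ^ 2 ≤ ((m₁ : ℝ) / R') ^ 2 := pow_le_pow_left₀ (by positivity) hq 2
    calc cL * (m₁ : ℝ) ^ 2 / (B : ℝ) ^ 2 / (m : ℝ) ^ 2 = cL * ((m₁ : ℝ) / ((B : ℝ) * m)) ^ 2 := by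
          field_simp
      _ ≤ cL * ((m₁ : ℝ) / R') ^ 2 := mul_le_mul_of_nonneg_left hq' hcL.le
  have hc' : 0 < cL * (m₁ : ℝ) ^ 2 / (B : ℝ) ^ 2 := by
    have : (0 : ℝ) < B := by exact_mod_cast (show 0 < B by omega)
    have : (0 : ℝ) < m₁ := by exact_mod_cast (show 0 < m₁ by omega)
    positivity
  exact DuminilCopinManolescuTassion2021_zdFiveArm_upperBound_of_pointBound_quasiMult hm1 ⟨C, hU⟩ ⟨c, hc, hQ⟩
    ⟨cL * (m₁ : ℝ) ^ 2 / (B : ℝ) ^ 2, hc', hL⟩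

end Assembly

end Literature.Probability.Percolation
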